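import Literature.NumberTheory.LFunctions.ClassicalPsiErrorTerm
import HarnessLib

/-!
# The classical `ψ`-estimate with explicit constants (uniform form of Landau's theorem)

Topic `Literature/NumberTheory/LFunctions`. Everything in this file is PROVED (theorems only).

`ClassicalPsiErrorTerm.lean` proves, under the hypotheses `Literature.ClassicalPsiData Λ F c C`
(`Λ ≥ 0`, `∑ Λ(n) n^{-s} = 1/(s−1) + F(s)` on `σ > 1`, `F` holomorphic with `|F(s)| ≤ C log(|t|+4)` on
the classical region `σ > 1 − c/log(|t|+4)`), Landau's estimate
`|∑_{n ≤ x} Λ(n) − x| ≤ C' x exp(−c'√log x)` (Montgomery–Vaughan Thm. 6.9 (6.12); Landau, Math. Ann. 56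
(1903) §§5–8) with the constants `c', C'` quantified *existentially after* the data. For the
Siegel–Walfisz theorem (Montgomery–Vaughan Cor. 11.19) the same estimate is needed for a family of
data indexed by the modulus `q` (`Λ = φ(q) Λ 𝟙_{n ≡ a (q)}`, the region and the bound depending on
`q`), with constants that are *explicit functions of `c` and `C`*. The proofs in
`ClassicalPsiErrorTerm.lean` are already effective; this file merely re-runs their last two steps
(the assembly of the five contour pieces, and Landau's differencing) keeping the constants in the
statements:

* `ClassicalPsiData.abs_rieszMean_sub_le_explicit` — for `x ≥ 3`,
  `|ψ₁(x) − (x−1)²/2| ≤ C (32e + 144π/c₁) x² exp(−(c₁/12)√log x)`, `c₁ = min(c, 1/2)`;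
* `ClassicalPsiData.abs_rieszMean_sub_sq_le_explicit` — the same recentred at `x²/2` with constant
  `C (32e + 144π/c₁) + 1`;
* `ClassicalPsiData.abs_psi_sub_le_explicit` — for `x ≥ 2`,
  `|ψ_Λ(x) − x| ≤ (1/4 + 8 C₄ + (ψ_Λ(6) + 6) e²/2) x exp(−(c₁/24)√log x)`,
  `C₄ = C (32e + 144π/c₁) + 1`.

(The dependence is polynomial in `C`, `1/c` and `ψ_Λ(6)`, which is all that the Siegel–Walfisz
application uses.)

## References

* E. Landau, *Neuer Beweis des Primzahlsatzes und Beweis des Primidealsatzes*, Math. Ann. 56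
  (1903), 645–670, §§5–8 (`LandauMathAnn1903`).
* H. L. Montgomery, R. C. Vaughan, *Multiplicative Number Theory I. Classical Theory*, CUP 2007,
  §6.2 Theorem 6.9 (6.12); §11.3 Theorem 11.16 and Corollary 11.19 (`MontgomeryVaughan2007`).
-/

noncomputable section

open Complex Filter Set MeasureTheory Real intervalIntegral
open scoped Topology Interval

namespace Literature.NumberTheory.LFunctions

namespace ClassicalPsiData

variable {Λ : ℕ → ℝ} {F : ℂ → ℂ} {c C : ℝ}

/-- **Landau's estimate for the Riesz mean, explicit constants** (Landau 1903 §7; Montgomery–Vaughan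
Thm. 6.9 via the classical region): under `ClassicalPsiData Λ F c C`, for `x ≥ 3`,
`|∑_{n ≤ x} Λ(n)(x − n) − (x − 1)²/2| ≤ C (32e + 12π/c₂) x² exp(−c₂ √log x)`, `c₂ = min(c, 1/2)/12`.
Same proof as `abs_rieszMean_sub_le` (`σ₀ = 1 + 1/log x`, `T = exp(√log x)`,
`σ₁ = 1 − min(c,1/2)/(4 log(T + 4))`), with the constant kept in the statement.
[cite: MontgomeryVaughan2007, Theorem 6.9 (6.12)] -/
theorem abs_rieszMean_sub_le_explicit (h : ClassicalPsiData Λ F c C) {x : ℝ} (hx : 3 ≤ x) :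
    |(∑ n ∈ Finset.Ioc 0 ⌊x⌋₊, Λ n * (x - n)) - (x - 1) ^ 2 / 2| ≤
      C * (32 * Real.exp 1 + 12 * π / (min c (1 / 2) / 12)) * x ^ 2 *
        Real.exp (-(min c (1 / 2) / 12 * Real.sqrt (Real.log x))) := by
  set c₁ : ℝ := min c (1 / 2) with hc₁
  have hc₁pos : 0 < c₁ := lt_min h.c_pos (by norm_num)
  have hc₁c : c₁ ≤ c := min_le_left _ _
  have hc₁h : c₁ ≤ 1 / 2 := min_le_right _ _
  have hC := h.C_nonneg
  have hc₂pos : 0 < c₁ / 12 := by positivity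
  set c₂ : ℝ := c₁ / 12 with hc₂
  have hc₂h : c₂ ≤ 1 / 24 := by rw [hc₂]; linarith
  -- parameters
  have hx1 : 1 ≤ x := by linarith
  have hx0 : 0 < x := by linarith
  set L : ℝ := Real.log x with hL
  have hL1 : 1 ≤ L := by
    rw [hL, ← Real.log_exp 1]
    exact Real.log_le_log (Real.exp_pos 1) (by linarith [Real.exp_one_lt_d9])
  have hL0 : 0 < L := by linarith
  set lam : ℝ := Real.sqrt L with hlam
  have hlam1 : 1 ≤ lam := Real.one_le_sqrt.2 hL1
  have hlam0 : 0 < lam := by linarith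
  have hlamsq : lam ^ 2 = L := Real.sq_sqrt hL0.le
  set T : ℝ := Real.exp lam with hT
  have hT1 : 1 ≤ T := Real.one_le_exp hlam0.le
  have hT0 : 0 < T := by linarith
  have hlogT : Real.log T = lam := Real.log_exp lam
  set ℓ : ℝ := Real.log (T + 4) with hℓ
  have hℓlam : lam ≤ ℓ := by rw [← hlogT, hℓ]; exact Real.log_le_log hT0 (by linarith)
  have hℓ1 : 1 ≤ ℓ := hlam1.trans hℓlam
  have hℓ0 : 0 < ℓ := by linarith
  have hℓle : ℓ ≤ 3 * lam := by
    have h5 : Real.log (T + 4) ≤ Real.log (Real.exp 2 * T) := by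
      refine Real.log_le_log (by linarith) ?_
      have he : (5 : ℝ) ≤ Real.exp 2 := by
        have h1 := Real.exp_one_gt_d9
        have h' : Real.exp 2 = Real.exp 1 * Real.exp 1 := by rw [← Real.exp_add]; norm_num
        rw [h']
        calc (5 : ℝ) ≤ 2.7182818283 * 2.7182818283 := by norm_num
          _ ≤ Real.exp 1 * Real.exp 1 :=
              mul_le_mul h1.le h1.le (by norm_num) (Real.exp_pos 1).le
      have := mul_le_mul_of_nonneg_right he hT0.le
      linarith
    rw [Real.log_mul (Real.exp_pos 2).ne' hT0.ne', Real.log_exp, hlogT] at h5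
    linarith
  set σ₀ : ℝ := 1 + 1 / L with hσ₀
  have hσ₀1 : 1 < σ₀ := by
    have : 0 < 1 / L := by positivity
    rw [hσ₀]; linarith
  have hσ₀2 : σ₀ ≤ 2 := by rw [hσ₀]; have := (div_le_one hL0).2 hL1; linarith
  set c' : ℝ := c₁ / 2 with hc'
  have hc'0 : 0 ≤ c' := by positivity
  have hc'c : c' < c := by linarith
  have hc'ℓ0 : 0 ≤ c' / ℓ := by positivity
  have hc'ℓ : c' / ℓ ≤ 1 / 4 := by rw [div_le_iff₀ hℓ0]; linarith
  set σ₁ : ℝ := 1 - c' / ℓ with hσ₁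
  have hσ₁34 : 3 / 4 ≤ σ₁ := by linarith
  have hσ₁1 : σ₁ ≤ 1 := by linarith
  have hσ₁0 : 0 < σ₁ := by linarith
  have hσ₁₀ : σ₁ ≤ σ₀ := by linarith
  have hσ₁c : 1 - c' / Real.log (T + 4) ≤ σ₁ := le_rfl
  -- powers of `x` and `T`
  have hxσ₀ : x ^ (1 + σ₀) = Real.exp 1 * x ^ 2 := by
    rw [hσ₀, show (1 : ℝ) + (1 + 1 / L) = 2 + 1 / L by ring, Real.rpow_add hx0, Real.rpow_two,
      Real.rpow_def_of_pos hx0, ← hL, mul_one_div_cancel hL0.ne', mul_comm]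
  have hxσ₁ : x ^ (1 + σ₁) ≤ x ^ 2 * Real.exp (-(2 * c₂ * lam)) := by
    rw [hσ₁, show (1 : ℝ) + (1 - c' / ℓ) = 2 + (-(c' / ℓ)) by ring, Real.rpow_add hx0,
      Real.rpow_two, Real.rpow_def_of_pos hx0, ← hL]
    have key : 2 * c₂ * lam ≤ L * (c' / ℓ) := by
      rw [mul_div_assoc' L, le_div_iff₀ hℓ0, ← hlamsq, hc', hc₂]
      have hprod := mul_le_mul_of_nonneg_left hℓle (mul_pos hc₁pos hlam0).le
      linarith
    have : L * -(c' / ℓ) ≤ -(2 * c₂ * lam) := by linarith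
    exact mul_le_mul_of_nonneg_left (Real.exp_le_exp.2 this) (by positivity)
  have hTpow : T ^ (-(1 / 2 : ℝ)) = Real.exp (-(lam / 2)) := by
    rw [hT, ← Real.exp_mul]; congr 1; ring
  have hT2 : 1 / T ^ 2 = Real.exp (-(2 * lam)) := by
    rw [hT, sq, ← Real.exp_add, Real.exp_neg, one_div]; congr 1; ring_nf
  -- exponential comparisons
  have hc₂lam : c₂ * lam ≤ 1 / 24 * lam := mul_le_mul_of_nonneg_right hc₂h hlam0.le
  have e1 : Real.exp (-(lam / 2)) ≤ Real.exp (-(c₂ * lam)) :=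
    Real.exp_le_exp.2 (by linarith)
  have e2 : lam * Real.exp (-(2 * c₂ * lam)) ≤ Real.exp (-(c₂ * lam)) / c₂ := by
    rw [le_div_iff₀ hc₂pos]
    have h1 : c₂ * lam ≤ Real.exp (c₂ * lam) := by linarith [Real.add_one_le_exp (c₂ * lam)]
    have h2 : Real.exp (c₂ * lam) * Real.exp (-(2 * c₂ * lam)) = Real.exp (-(c₂ * lam)) := by
      rw [← Real.exp_add]; ring_nf
    calc lam * Real.exp (-(2 * c₂ * lam)) * c₂ = (c₂ * lam) * Real.exp (-(2 * c₂ * lam)) := by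
          ring
      _ ≤ Real.exp (c₂ * lam) * Real.exp (-(2 * c₂ * lam)) := by gcongr
      _ = Real.exp (-(c₂ * lam)) := h2
  have e3 : lam * Real.exp (-(2 * lam)) ≤ Real.exp (-(c₂ * lam)) := by
    have h1 : lam ≤ Real.exp lam := by linarith [Real.add_one_le_exp lam]
    have h2 : Real.exp lam * Real.exp (-(2 * lam)) = Real.exp (-lam) := by
      rw [← Real.exp_add]; ring_nf
    calc lam * Real.exp (-(2 * lam)) ≤ Real.exp lam * Real.exp (-(2 * lam)) := by gcongr
      _ = Real.exp (-lam) := h2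
      _ ≤ Real.exp (-(c₂ * lam)) := Real.exp_le_exp.2 (by linarith)
  -- Perron, Cauchy, and the five bounds
  have hint := h.integrable_Phi hx0 hσ₀1
  have hA := h.rieszMean_sub_mainTerm_eq hx1 hσ₀1
  have hsplit := h.integral_line_eq hx0 hc'0 hc'c hT0 hσ₁0 hσ₁₀ hσ₁c hint
  have b1 := h.norm_integral_Iic_le hx1 hσ₀1.le hT1
  have b2 := h.norm_integral_Ioi_le hx1 hσ₀1.le hT1
  have b3 := h.norm_integral_left_le hx1 hc'0 hc'c hT0 (by linarith : 1 / 2 ≤ σ₁) hσ₁c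
  have b4 := h.norm_integral_horizontal_le hx1 hc'0 hc'c hT0 hσ₁₀ hσ₁c (T' := -T)
    (by rw [abs_neg, abs_of_pos hT0])
  have b5 := h.norm_integral_horizontal_le hx1 hc'0 hc'c hT0 hσ₁₀ hσ₁c (T' := T) (abs_of_pos hT0)
  simp only [ofReal_neg, neg_mul] at b4 hsplit
  -- sizes of the pieces
  have s12 : 10 * C * x ^ (1 + σ₀) * T ^ (-(1 / 2 : ℝ)) ≤
      10 * C * Real.exp 1 * x ^ 2 * Real.exp (-(c₂ * lam)) := by
    rw [hxσ₀, hTpow]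
    calc 10 * C * (Real.exp 1 * x ^ 2) * Real.exp (-(lam / 2))
        = (10 * C * Real.exp 1 * x ^ 2) * Real.exp (-(lam / 2)) := by ring
      _ ≤ (10 * C * Real.exp 1 * x ^ 2) * Real.exp (-(c₂ * lam)) :=
          mul_le_mul_of_nonneg_left e1 (by positivity)
  have s3 : 4 * π * C * Real.log (T + 4) * x ^ (1 + σ₁) ≤
      12 * π * C * x ^ 2 * (Real.exp (-(c₂ * lam)) / c₂) := by
    calc 4 * π * C * Real.log (T + 4) * x ^ (1 + σ₁)
        ≤ 4 * π * C * (3 * lam) * (x ^ 2 * Real.exp (-(2 * c₂ * lam))) := by gcongr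
      _ = 12 * π * C * x ^ 2 * (lam * Real.exp (-(2 * c₂ * lam))) := by ring
      _ ≤ 12 * π * C * x ^ 2 * (Real.exp (-(c₂ * lam)) / c₂) := by gcongr
  have s45 : C * Real.log (T + 4) * x ^ (1 + σ₀) / T ^ 2 * (σ₀ - σ₁) ≤
      6 * Real.exp 1 * C * x ^ 2 * Real.exp (-(c₂ * lam)) := by
    rw [hxσ₀, div_eq_mul_one_div _ (T ^ 2), hT2]
    calc C * Real.log (T + 4) * (Real.exp 1 * x ^ 2) * Real.exp (-(2 * lam)) * (σ₀ - σ₁)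
        ≤ C * (3 * lam) * (Real.exp 1 * x ^ 2) * Real.exp (-(2 * lam)) * 2 := by
          gcongr
          · linarith
      _ = 6 * Real.exp 1 * C * x ^ 2 * (lam * Real.exp (-(2 * lam))) := by ring
      _ ≤ 6 * Real.exp 1 * C * x ^ 2 * Real.exp (-(c₂ * lam)) := by gcongr
  -- the norm of the line integral
  have hI : ∀ z : ℂ, ‖I * z‖ = ‖z‖ := fun z ↦ by rw [norm_mul, norm_I, one_mul]
  have hline : ‖∫ t : ℝ, Phi F x (σ₀ + t * I)‖ ≤
      C * (32 * Real.exp 1 + 12 * π / c₂) * x ^ 2 * Real.exp (-(c₂ * lam)) := by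
    rw [hsplit]
    refine (norm_add_add_add_sub_le _ _ _ _ _).trans ?_
    rw [hI, hI]
    have := add_le_add (add_le_add (add_le_add (add_le_add (b1.trans s12) (b2.trans s12))
      (b3.trans s3)) (b4.trans s45)) (b5.trans s45)
    refine this.trans (le_of_eq ?_)
    field_simp
    ring
  -- conclusion
  have hreal : (((∑ n ∈ Finset.Ioc 0 ⌊x⌋₊, Λ n * (x - n)) - (x - 1) ^ 2 / 2 : ℝ) : ℂ) =
      (1 / (2 * π) : ℂ) * ∫ t : ℝ, Phi F x (σ₀ + t * I) := by
    rw [← hA]; push_cast; ring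
  rw [← Real.norm_eq_abs, ← Complex.norm_real, hreal, norm_mul]
  have h2π : ‖(1 / (2 * π) : ℂ)‖ ≤ 1 := by
    rw [show (1 / (2 * π) : ℂ) = ((1 / (2 * π) : ℝ) : ℂ) by push_cast; ring, Complex.norm_real,
      Real.norm_eq_abs, abs_of_pos (by positivity)]
    rw [div_le_one (by positivity)]
    linarith [Real.two_le_pi]
  calc ‖(1 / (2 * π) : ℂ)‖ * ‖∫ t : ℝ, Phi F x (σ₀ + t * I)‖
      ≤ 1 * (C * (32 * Real.exp 1 + 12 * π / c₂) * x ^ 2 * Real.exp (-(c₂ * lam))) := by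
        gcongr
    _ = C * (32 * Real.exp 1 + 12 * π / c₂) * x ^ 2 * Real.exp (-(c₂ * lam)) := one_mul _

/-- The explicit `ψ₁`-estimate recentred at `x²/2`: for `y ≥ 3`,
`|ψ₁(y) − y²/2| ≤ (C (32e + 12π/c₂) + 1) y² exp(−c₂ √log y)`, `c₂ = min(c,1/2)/12`
(absorb `y − 1/2 ≤ y ≤ y² e^{−c₂√log y}`). [cite: LandauMathAnn1903, §7] -/
theorem abs_rieszMean_sub_sq_le_explicit (h : ClassicalPsiData Λ F c C) {y : ℝ} (hy : 3 ≤ y) :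
    |rieszMean Λ y - y ^ 2 / 2| ≤
      (C * (32 * Real.exp 1 + 12 * π / (min c (1 / 2) / 12)) + 1) * y ^ 2 *
        Real.exp (-(min c (1 / 2) / 12 * Real.sqrt (Real.log y))) := by
  set C₃ : ℝ := C * (32 * Real.exp 1 + 12 * π / (min c (1 / 2) / 12))
  have hψ₁ : ∀ x : ℝ, 3 ≤ x → |(∑ n ∈ Finset.Ioc 0 ⌊x⌋₊, Λ n * (x - n)) - (x - 1) ^ 2 / 2| ≤
      C₃ * x ^ 2 * Real.exp (-(min c (1 / 2) / 12 * Real.sqrt (Real.log x))) :=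
    fun x hx ↦ h.abs_rieszMean_sub_le_explicit hx
  have hC := h.C_nonneg
  have hcmin : 0 < min c (1 / 2) := lt_min h.c_pos (by norm_num)
  have hC₃ : 0 ≤ C₃ := by positivity
  clear_value C₃
  have hc₂ : min c (1 / 2) / 12 ≤ 1 := by have := min_le_right c (1 / 2); linarith
  have hy0 : 0 < y := by linarith
  set c₂ : ℝ := min c (1 / 2) / 12
  set lam : ℝ := Real.sqrt (Real.log y) with hlam
  have h1 : |rieszMean Λ y - (y - 1) ^ 2 / 2| ≤ C₃ * y ^ 2 * Real.exp (-(c₂ * lam)) := hψ₁ y hy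
  have hL1 : 1 ≤ Real.log y := by
    rw [← Real.log_exp 1]
    exact Real.log_le_log (Real.exp_pos 1) (by linarith [Real.exp_one_lt_d9])
  have hl1 : 1 ≤ lam := Real.one_le_sqrt.2 hL1
  have h2 : y ≤ y ^ 2 * Real.exp (-(c₂ * lam)) := by
    have hsq : lam ^ 2 = Real.log y := Real.sq_sqrt (by linarith)
    have h4 : c₂ * lam ≤ 1 * lam := mul_le_mul_of_nonneg_right hc₂ (by linarith)
    have h4' : lam * 1 ≤ lam * lam := mul_le_mul_of_nonneg_left hl1 (by linarith)
    have h3 : c₂ * lam ≤ Real.log y := by nlinarith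
    have h5 : Real.exp (c₂ * lam) ≤ y := by
      calc Real.exp (c₂ * lam) ≤ Real.exp (Real.log y) := Real.exp_le_exp.2 h3
        _ = y := Real.exp_log hy0
    rw [Real.exp_neg, ← div_eq_mul_inv, le_div_iff₀ (Real.exp_pos _), sq]
    exact mul_le_mul_of_nonneg_left h5 hy0.le
  have h3 : |rieszMean Λ y - y ^ 2 / 2| ≤ |rieszMean Λ y - (y - 1) ^ 2 / 2| + y := by
    have : rieszMean Λ y - y ^ 2 / 2 = (rieszMean Λ y - (y - 1) ^ 2 / 2) - (y - 1 / 2) := by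
      ring
    rw [this]
    refine (abs_sub _ _).trans ?_
    rw [abs_of_pos (by linarith : 0 < y - 1 / 2)]
    linarith
  calc |rieszMean Λ y - y ^ 2 / 2|
      ≤ C₃ * y ^ 2 * Real.exp (-(c₂ * lam)) + y ^ 2 * Real.exp (-(c₂ * lam)) := by
        linarith [h1, h2, h3]
    _ = (C₃ + 1) * y ^ 2 * Real.exp (-(c₂ * lam)) := by ring

/-- **The classical `ψ`-estimate, explicit constants** (Montgomery–Vaughan Thm. 6.9 (6.12); Landau
1903 §8): under `ClassicalPsiData Λ F c C`, for every `x ≥ 2`,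
`|∑_{n ≤ x} Λ(n) − x| ≤ (1/4 + 8 C₄ + (ψ_Λ(6) + 6) e²/2) · x · exp(−(c₂/2) √log x)` with
`c₂ = min(c,1/2)/12`, `C₄ = C (32e + 12π/c₂) + 1`. Same differencing proof as `abs_psi_sub_le`
(`h = ½ x e^{−(c₂/2)√log x}`), constants kept in the statement.
[cite: MontgomeryVaughan2007, Theorem 6.9 (6.12)] -/
theorem abs_psi_sub_le_explicit (h : ClassicalPsiData Λ F c C) {x : ℝ} (hx : 2 ≤ x) :
    |psi Λ x - x| ≤
      ((1 / 4 + 8 * (C * (32 * Real.exp 1 + 12 * π / (min c (1 / 2) / 12)) + 1)) +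
          (psi Λ 6 + 6) * (Real.exp 2 / 2)) * x *
        Real.exp (-(min c (1 / 2) / 12 / 2) * Real.sqrt (Real.log x)) := by
  set C₄ : ℝ := C * (32 * Real.exp 1 + 12 * π / (min c (1 / 2) / 12)) + 1
  have hE : ∀ y : ℝ, 3 ≤ y → |rieszMean Λ y - y ^ 2 / 2| ≤
      C₄ * y ^ 2 * Real.exp (-(min c (1 / 2) / 12 * Real.sqrt (Real.log y))) :=
    fun y hy ↦ h.abs_rieszMean_sub_sq_le_explicit hy
  have hC := h.C_nonneg
  have hcmin : 0 < min c (1 / 2) := lt_min h.c_pos (by norm_num)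
  have hC₄ : 0 ≤ C₄ := by positivity
  clear_value C₄
  set c₂ : ℝ := min c (1 / 2) / 12 with hc₂
  have hc₂pos : 0 < c₂ := by have := h.c_pos; positivity
  have hc₂le : c₂ ≤ 1 / 24 := by have := min_le_right c (1 / 2); rw [hc₂]; linarith
  have hΛ := h.nonneg
  have hψ6 := psi_nonneg hΛ 6
  have he6 : (6 : ℝ) ≤ Real.exp 2 := by
    have h1 := Real.exp_one_gt_d9
    have h' : Real.exp 2 = Real.exp 1 * Real.exp 1 := by rw [← Real.exp_add]; norm_num
    rw [h']
    calc (6 : ℝ) ≤ 2.7182818283 * 2.7182818283 := by norm_num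
      _ ≤ Real.exp 1 * Real.exp 1 := mul_le_mul h1.le h1.le (by norm_num) (Real.exp_pos 1).le
  have hx0 : 0 < x := by linarith
  set lam : ℝ := Real.sqrt (Real.log x) with hlam
  have hlam0 : 0 ≤ lam := Real.sqrt_nonneg _
  set u : ℝ := Real.exp (-(c₂ / 2) * lam) with hu
  have hu0 : 0 < u := Real.exp_pos _
  have hu1 : u ≤ 1 := Real.exp_le_one_iff.2 (by nlinarith)
  show |psi Λ x - x| ≤ ((1 / 4 + 8 * C₄) + (psi Λ 6 + 6) * (Real.exp 2 / 2)) * x * u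
  have hpos1 : 0 ≤ (1 / 4 + 8 * C₄) * x * u := by positivity
  have hpos2 : 0 ≤ (psi Λ 6 + 6) * (Real.exp 2 / 2) * x * u := by positivity
  rcases lt_or_ge x 6 with hx6 | hx6
  · -- small `x`: `ψ` is bounded by `ψ(6)`
    have hψx : psi Λ x ≤ psi Λ 6 := psi_mono hΛ hx6.le
    have hψ0 := psi_nonneg hΛ x
    have h1 : |psi Λ x - x| ≤ psi Λ 6 + 6 := by rw [abs_le]; constructor <;> linarith
    have hlam2 : lam ≤ 2 := by
      rw [hlam, Real.sqrt_le_left (by norm_num)]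
      have : Real.log x ≤ Real.log (Real.exp 2) := Real.log_le_log hx0 (by linarith)
      rw [Real.log_exp] at this
      linarith
    have h2 : Real.exp (-2) ≤ u := by
      refine Real.exp_le_exp.2 ?_
      have : c₂ / 2 * lam ≤ 1 * 2 := mul_le_mul (by linarith) hlam2 hlam0 (by norm_num)
      linarith
    have h4 : (1 : ℝ) ≤ Real.exp 2 / 2 * x * u := by
      calc (1 : ℝ) = Real.exp 2 / 2 * 2 * Real.exp (-2) := by rw [Real.exp_neg]; field_simp
        _ ≤ Real.exp 2 / 2 * x * u := by gcongr
    calc |psi Λ x - x| ≤ (psi Λ 6 + 6) * 1 := by linarith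
      _ ≤ (psi Λ 6 + 6) * (Real.exp 2 / 2 * x * u) :=
          mul_le_mul_of_nonneg_left h4 (by linarith)
      _ = (psi Λ 6 + 6) * (Real.exp 2 / 2) * x * u := by ring
      _ ≤ ((1 / 4 + 8 * C₄) + (psi Λ 6 + 6) * (Real.exp 2 / 2)) * x * u := by linarith
  · -- `x ≥ 6`: differencing with `h = x u / 2`
    have hx3 : (3 : ℝ) ≤ x := by linarith
    have huu : Real.exp (-(c₂ * lam)) = u * u := by rw [hu, ← Real.exp_add]; ring_nf
    have hxu : x * u / 2 ≤ x / 2 := by nlinarith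
    have hxu0 : 0 < x * u / 2 := by positivity
    have hEx : |rieszMean Λ x - x ^ 2 / 2| ≤ C₄ * x ^ 2 * (u * u) := by rw [← huu]; exact hE x hx3
    -- upper bound, `y = x + xu/2`
    have hup : psi Λ x - x ≤ (1 / 4 + 8 * C₄) * x * u := by
      have hy3 : 3 ≤ x + x * u / 2 := by linarith
      have hxy : x ≤ x + x * u / 2 := by linarith
      have hd := sub_mul_psi_le hΛ (by linarith : 0 ≤ x + x * u / 2) hxy
      have hEy : |rieszMean Λ (x + x * u / 2) - (x + x * u / 2) ^ 2 / 2| ≤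
          C₄ * (9 / 4 * x ^ 2) * (u * u) := by
        refine (hE _ hy3).trans ?_
        have hl : Real.exp (-(c₂ * Real.sqrt (Real.log (x + x * u / 2)))) ≤ u * u := by
          rw [← huu]
          refine Real.exp_le_exp.2 ?_
          have := Real.sqrt_le_sqrt (Real.log_le_log hx0 hxy)
          have := mul_le_mul_of_nonneg_left this hc₂pos.le
          linarith
        have hy2 : (x + x * u / 2) ^ 2 ≤ 9 / 4 * x ^ 2 := by nlinarith
        have hfin : C₄ * (x + x * u / 2) ^ 2 *
            Real.exp (-(c₂ * Real.sqrt (Real.log (x + x * u / 2)))) ≤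
            C₄ * (9 / 4 * x ^ 2) * (u * u) := by gcongr
        exact hfin
      have a1 := (abs_le.1 hEy).2
      have a2 := (abs_le.1 hEx).1
      have key : (x * u / 2) * (psi Λ x - x) ≤ (x * u / 2) * ((1 / 4 + 8 * C₄) * x * u) := by
        have hsq : 0 ≤ C₄ * (x * u) ^ 2 := by positivity
        nlinarith [hd, a1, a2, hsq]
      exact le_of_mul_le_mul_left key hxu0
    -- lower bound, `y = x − xu/2`
    have hlow : -((1 / 4 + 8 * C₄) * x * u) ≤ psi Λ x - x := by
      have hy3 : 3 ≤ x - x * u / 2 := by linarith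
      have hyx : x - x * u / 2 ≤ x := by linarith
      have hd := rieszMean_sub_le hΛ hyx
      have hEy : |rieszMean Λ (x - x * u / 2) - (x - x * u / 2) ^ 2 / 2| ≤
          C₄ * x ^ 2 * (3 * (u * u)) := by
        refine (hE _ hy3).trans ?_
        have hl : Real.exp (-(c₂ * Real.sqrt (Real.log (x - x * u / 2)))) ≤ 3 * (u * u) := by
          have hs := sqrt_log_sub_one_le hx6 (by linarith : x / 2 ≤ x - x * u / 2)
          have hs' := mul_le_mul_of_nonneg_left hs hc₂pos.le
          have he3 : Real.exp c₂ ≤ 3 :=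
            ((Real.exp_le_exp.2 (by linarith : c₂ ≤ 1)).trans Real.exp_one_lt_d9.le).trans
              (by norm_num)
          calc Real.exp (-(c₂ * Real.sqrt (Real.log (x - x * u / 2))))
              ≤ Real.exp (c₂ + -(c₂ * lam)) := Real.exp_le_exp.2 (by linarith)
            _ = Real.exp c₂ * (u * u) := by rw [Real.exp_add, huu]
            _ ≤ 3 * (u * u) := by gcongr
        have hy2 : (x - x * u / 2) ^ 2 ≤ x ^ 2 := by nlinarith
        have hfin : C₄ * (x - x * u / 2) ^ 2 *
            Real.exp (-(c₂ * Real.sqrt (Real.log (x - x * u / 2)))) ≤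
            C₄ * x ^ 2 * (3 * (u * u)) := by gcongr
        exact hfin
      have a1 := (abs_le.1 hEy).2
      have a2 := (abs_le.1 hEx).1
      have key : (x * u / 2) * (-((1 / 4 + 8 * C₄) * x * u)) ≤ (x * u / 2) * (psi Λ x - x) := by
        linarith [hd, a1, a2]
      exact le_of_mul_le_mul_left key hxu0
    calc |psi Λ x - x| ≤ (1 / 4 + 8 * C₄) * x * u := abs_le.2 ⟨hlow, hup⟩
      _ ≤ ((1 / 4 + 8 * C₄) + (psi Λ 6 + 6) * (Real.exp 2 / 2)) * x * u := by linarith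

end ClassicalPsiData

end Literature.NumberTheory.LFunctions
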